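import Summits.BirchSwinnertonDyer.BirchSwinnertonDyer.Theorems.ManinLocalTwoThreeGenerationOfNamedInputs
import Summits.BirchSwinnertonDyer.BirchSwinnertonDyer.Theorems.ManinLocalTwoThreeRelativeIharaShiftVanishingBarHolds
import Literature.NumberTheory.EllipticCurves.ModPIrreducibleNotEisensteinProofs
import HarnessLib

/-!
# E-es-19 `ShiftClassGenerationThree` is a THEOREM (C3 generation leaf; stub 3 of line `kato_shift_three` BY NAME)

Summit `BirchSwinnertonDyer`, route `ManinLocalTwoThree` (cell bsd-f2-manin), crux C3 `ManinPrimeToThreeAtNine`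
(stmt-BirchSwinnertonDyer-22968), Euler-system line `kato_shift_three` (`Cruxes/ManinPrimeToThreeAtNine/Lines/kato_shift_three.lean`,
registration copy v2; stub 3 `stub_shiftClass_generation : ShiftClassGenerationThree`).  The cell's leaf E-es-19
`Summit.BirchSwinnertonDyer.Rank1Residual.ManinAdditive.ShiftClassGenerationThree` (`@[conjecture]`, `KatoShiftThreeLaws.lean`,
p581159: for `W[3]` irreducible and `9 ∣ N` the shift classes `{a/ℓ, 3a/ℓ}_f` over admissible primes `ℓ ≥ ℓ₀` span a subgroup of
`Λ_f` of index prime to `3` — «Ihara-type generation for diag(3,1) at 9 ∣ N; NOT in print; data 76/76 levels») is now closed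
UNCONDITIONALLY by composing three tree theorems:

* `shiftClassGenerationThree_of_relativeIharaShiftVanishingBar (hRI) (hF)` (p598521, typer hand-over: E-es-19 ⟸ the relative-Ihara
  leaf E-es-25(3,3,1) ∧ the named fact «irreducible `W[p]` ⟹ `a_ℓ mod p` is not an Eisenstein system»);
* `relativeIharaShiftVanishingBar_holds 3 3 1` (p604347, seat p2: E-es-25 for parabolic classes via the cusp-symbol lift, LEMMA G,
  the relative Ihara statement on `Γ₀(L′; ℤ[1/t])` and parabolicity of generalised Hecke eigen-cocycles);
* `Literature.NumberTheory.EllipticCurves.not_isEisensteinEigensystem_of_hasIrreducibleModPGaloisRep_holds` (p612172, seat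
  bsd-cited-r07: Frobenius density in division form + the invariant-line lemma + complex conjugation).

Results: `shiftClassGenerationThree_holds : ShiftClassGenerationThree` and the line's stub BY NAME
`Summit.BirchSwinnertonDyer.BirchSwinnertonDyer.Theorems.stub_shiftClass_generation`.  After this the `kato_shift_three` line's
open stubs are the Kato fact F-es-18 `kato_neron_isIntegral_twistedSymbolSum_of_additive_three_polar` (Literature, XL), the
ES hole-step `stub_three_dvd_shiftClass` and the `W[3]`-reducible residual `ManinPrimeToThreeOfReducible` (the skeleton of record
of C3 is currently `honda_contraction` v3; this file serves the Euler-system line).  No definitions; axioms standard.  Nothing about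
BSD or Manin's conjecture is proved here.  References: K. Ribet, ICM 1983 / Invent. Math. 100 (1990) (Ihara's lemma, the `ℓ ≠ p`
shape); H. Darmon, F. Diamond, R. Taylor, *Fermat's Last Theorem* (1995) Lemma 4.28; cell memo HOME/MEMO-es.md §18.4, §21–§23.
-/

-- the gate's namespace `Summit.BirchSwinnertonDyer.BirchSwinnertonDyer.…` repeats the summit name (single-conjunct summit)
set_option linter.dupNamespace false

noncomputable section

open Summit.BirchSwinnertonDyer.Rank1Residual.ManinAdditive

namespace Summit.BirchSwinnertonDyer.BirchSwinnertonDyer.Theorems.ManinLocalTwoThree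

/-- **E-es-19 `ShiftClassGenerationThree` holds** (unconditionally): E-es-25(3,3,1) (`relativeIharaShiftVanishingBar_holds`) and
the discharged «irreducible ⟹ not Eisenstein» fact fed to `shiftClassGenerationThree_of_relativeIharaShiftVanishingBar`.
[cite: DarmonDiamondTaylor1995, Lemma 4.28 (shape only: Ihara's lemma at a prime dividing the level; the diagonal statement at 9 ∣ N is the cell's E-es-19, proved here in the tree)] -/
theorem shiftClassGenerationThree_holds : ShiftClassGenerationThree :=
  shiftClassGenerationThree_of_relativeIharaShiftVanishingBar (relativeIharaShiftVanishingBar_holds 3 3 1)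
    Literature.NumberTheory.EllipticCurves.not_isEisensteinEigensystem_of_hasIrreducibleModPGaloisRep_holds

end Summit.BirchSwinnertonDyer.BirchSwinnertonDyer.Theorems.ManinLocalTwoThree

namespace Summit.BirchSwinnertonDyer.BirchSwinnertonDyer.Theorems

/-- **Stub 3 `stub_shiftClass_generation` of line `kato_shift_three` (crux `ManinPrimeToThreeAtNine`, stmt-BirchSwinnertonDyer-22968)
BY NAME**: the generation leaf E-es-19 is a theorem. [cite: DarmonDiamondTaylor1995, Lemma 4.28 (shape only; see `ManinLocalTwoThree.shiftClassGenerationThree_holds`)] -/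
theorem stub_shiftClass_generation : ShiftClassGenerationThree :=
  ManinLocalTwoThree.shiftClassGenerationThree_holds

end Summit.BirchSwinnertonDyer.BirchSwinnertonDyer.Theorems

end
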